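import Literature.AnabelianGeometry.AbsoluteAnabelian.AbsTopICharacterRankProofs
import HarnessLib

/-!
# [AbsTopI] Lemma 4.5 (ii): print's `τ(M)` ("the sum … of ANY admissible filtration") EQUALS the
# trunk's `quasiTrivialRank` — admissible filtrations exist and all have the same quasi-trivial total

Proof-only companion of `AbsTopICharacterRank.lean` (S. Mochizuki, *Topics in Absolute Anabelian
Geometry I: Generalities* [MochizukiAbsTopI2012], Lemma 4.5 (ii), kurims manuscript p. 54; the
definition of `τ(M)` is [CombGC] Def. 2.3 (i)): FACT-LIST row **F-0226 `StableChain.IsAdmissible`**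
(cell abc-iut, block F, seat abc-iut-f-062) and the faithfulness of the trunk's closed-form typing of
`τ(M)`.  Print (p. 54): "`τ(M)` := the sum of the `ℚ_l`-dimensions of the quasi-trivial subquotients
`M_j/M_{j+1}` … of any filtration `M_n ⊆ … ⊆ M_0 = M` of `M` by `ℚ_l[G]`-modules such that each
`M_j/M_{j+1}` is either quasi-trivial or has no nontrivial subquotients".  The trunk types `τ(M)` as
the SUPREMUM of these totals over ALL stable filtrations and says (module docstring) "by Jordan–Hölder
all admissible filtrations give the same total, and refinement only moves dimension INTO quasi-trivial
steps, so that common value is the supremum".  This file PROVES that sentence in the kernel — without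
Jordan–Hölder, by the modular-lattice splitting `d ↦ (d ⊓ M_{k+1}, d ⊔ M_{k+1})` and
`dim(A ⊔ N) + dim(A ⊓ N) = dim A + dim N`:

* `StableChain.qtDim_le_of_isAdmissible`: every stable filtration's quasi-trivial total is `≤` that
  of any ADMISSIBLE filtration; hence `StableChain.IsAdmissible.qtDim_eq_quasiTrivialRank`:
  **print's `τ(M)` computed with any admissible filtration = `quasiTrivialRank`**;
* `StableChain.exists_isAdmissible`: a finite-dimensional `M` HAS an admissible filtration (even one
  all of whose steps have no nontrivial subquotients) — so print's definition is never vacuous;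
* F-0226 kernel events: the universal closure "every stable filtration is admissible" is FALSE
  (`not_forall_isAdmissible`: `ℚˣ` acting by scalars on `ℚ²`, filtration `ℚ² ⊇ 0`), while the
  instance forms `isAdmissible_trivial_iff`, `isAdmissible_trivial_of_quasiTrivial` and the two
  theorems above are what the predicate is FOR.
No new definitions.  HONEST FRAMING: refereed pre-IUT anabelian geometry; statements about OUR typing
of [AbsTopI] Lemma 4.5 (ii); nothing here bears on [IUTchIII] Cor. 3.12.
-/

noncomputable section

open scoped Classical

namespace Literature.AnabelianGeometry.AbsoluteAnabelian.AbsTopI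

universe u v w

section Admissible

variable {G : Type u} [Group G] [TopologicalSpace G]
variable {K : Type v} [Field K] {M : Type w} [AddCommGroup M] [Module K M]

/-! ### Stable submodules form a sublattice; quasi-trivial steps split along a stable submodule -/

omit [TopologicalSpace G] in
/-- `⊥` is stable. [cite: MochizukiAbsTopI2012, Lemma 4.5 (ii) p.54] -/
theorem isStable_bot (ρ : G →* (M ≃ₗ[K] M)) : IsStable ρ ⊥ := fun g m hm => by
  rw [Submodule.mem_bot] at hm ⊢
  rw [hm, map_zero]

omit [TopologicalSpace G] in
/-- `⊤` is stable. [cite: MochizukiAbsTopI2012, Lemma 4.5 (ii) p.54] -/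
theorem isStable_top (ρ : G →* (M ≃ₗ[K] M)) : IsStable ρ ⊤ := fun _ _ _ => Submodule.mem_top

omit [TopologicalSpace G] in
/-- Intersections of stable submodules are stable. [cite: MochizukiAbsTopI2012, Lemma 4.5 (ii) p.54] -/
theorem IsStable.inf {ρ : G →* (M ≃ₗ[K] M)} {N P : Submodule K M} (hN : IsStable ρ N)
    (hP : IsStable ρ P) : IsStable ρ (N ⊓ P) := fun g _ hm =>
  Submodule.mem_inf.2 ⟨hN g _ (Submodule.mem_inf.1 hm).1, hP g _ (Submodule.mem_inf.1 hm).2⟩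

omit [TopologicalSpace G] in
/-- Sums of stable submodules are stable. [cite: MochizukiAbsTopI2012, Lemma 4.5 (ii) p.54] -/
theorem IsStable.sup {ρ : G →* (M ≃ₗ[K] M)} {N P : Submodule K M} (hN : IsStable ρ N)
    (hP : IsStable ρ P) : IsStable ρ (N ⊔ P) := by
  intro g m hm
  obtain ⟨n, hn, p, hp, rfl⟩ := Submodule.mem_sup.1 hm
  rw [map_add]
  exact Submodule.add_mem _ (Submodule.mem_sup_left (hN g n hn)) (Submodule.mem_sup_right (hP g p hp))

/-- A quasi-trivial step stays quasi-trivial after intersecting both terms with a stable submodule.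
[cite: MochizukiAbsTopI2012, Lemma 4.5 (ii) p.54] -/
theorem IsQuasiTrivialStep.inf_right {ρ : G →* (M ≃ₗ[K] M)} {N N' P : Submodule K M}
    (h : IsQuasiTrivialStep ρ N N') (hP : IsStable ρ P) :
    IsQuasiTrivialStep ρ (N ⊓ P) (N' ⊓ P) := by
  obtain ⟨U, hU, hfi, hact⟩ := h
  refine ⟨U, hU, hfi, fun g hg m hm => ?_⟩
  obtain ⟨hmN, hmP⟩ := Submodule.mem_inf.1 hm
  exact Submodule.mem_inf.2 ⟨hact g hg m hmN, Submodule.sub_mem _ (hP g m hmP) hmP⟩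

/-- A quasi-trivial step stays quasi-trivial after adding a stable submodule to both terms.
[cite: MochizukiAbsTopI2012, Lemma 4.5 (ii) p.54] -/
theorem IsQuasiTrivialStep.sup_right {ρ : G →* (M ≃ₗ[K] M)} {N N' P : Submodule K M}
    (h : IsQuasiTrivialStep ρ N N') (hP : IsStable ρ P) :
    IsQuasiTrivialStep ρ (N ⊔ P) (N' ⊔ P) := by
  obtain ⟨U, hU, hfi, hact⟩ := h
  refine ⟨U, hU, hfi, fun g hg m hm => ?_⟩
  obtain ⟨n, hn, p, hp, rfl⟩ := Submodule.mem_sup.1 hm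
  have e : ρ g (n + p) - (n + p) = (ρ g n - n) + (ρ g p - p) := by rw [map_add]; abel
  rw [e]
  exact Submodule.add_mem _ (Submodule.mem_sup_left (hact g hg n hn))
    (Submodule.mem_sup_right (Submodule.sub_mem _ (hP g p hp) hp))

/-- The modular-lattice splitting of a step `A' ≤ A` along `N`:
`dim A − dim A' = (dim(A ⊓ N) − dim(A' ⊓ N)) + (dim(A ⊔ N) − dim(A' ⊔ N))`.
[cite: MochizukiAbsTopI2012, Lemma 4.5 (ii) p.54] -/
theorem finrank_sub_finrank_eq_inf_add_sup [FiniteDimensional K M] {A A' : Submodule K M}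
    (h : A' ≤ A) (N : Submodule K M) :
    Module.finrank K A - Module.finrank K A' =
      (Module.finrank K ↥(A ⊓ N) - Module.finrank K ↥(A' ⊓ N)) +
        (Module.finrank K ↥(A ⊔ N) - Module.finrank K ↥(A' ⊔ N)) := by
  have h1 := Submodule.finrank_sup_add_finrank_inf_eq A N
  have h2 := Submodule.finrank_sup_add_finrank_inf_eq A' N
  have m0 : Module.finrank K A' ≤ Module.finrank K A := Submodule.finrank_mono h
  have m1 : Module.finrank K ↥(A' ⊓ N) ≤ Module.finrank K ↥(A ⊓ N) :=
    Submodule.finrank_mono (inf_le_inf_right N h)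
  have m2 : Module.finrank K ↥(A' ⊔ N) ≤ Module.finrank K ↥(A ⊔ N) :=
    Submodule.finrank_mono (sup_le_sup_right h N)
  omega

/-! ### Every filtration's quasi-trivial total is bounded by that of an admissible filtration -/

/-- A monotone family of stable submodules squeezed between the two terms of an ADMISSIBLE step
`L ⊇ N` has quasi-trivial total at most the contribution of that step: by telescoping if the step is
quasi-trivial, and because every member is `N` or `L` if the step has no nontrivial subquotients.
[cite: MochizukiAbsTopI2012, Lemma 4.5 (ii) p.54] -/
theorem sum_qtDim_le_of_squeezed [FiniteDimensional K M] {ρ : G →* (M ≃ₗ[K] M)}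
    {L N : Submodule K M} (hNL : N ≤ L) (hadm : IsQuasiTrivialStep ρ L N ∨ IsSimpleStep ρ L N)
    (b : ℕ → Submodule K M) (n : ℕ) (hle : ∀ i, b i ≤ L) (hge : ∀ i, N ≤ b i)
    (hanti : ∀ i < n, b (i + 1) ≤ b i) (hst : ∀ i, IsStable ρ (b i)) :
    (∑ i ∈ Finset.range n,
        if IsQuasiTrivialStep ρ (b i) (b (i + 1)) then
          Module.finrank K ↥(b i) - Module.finrank K ↥(b (i + 1)) else 0) ≤
      if IsQuasiTrivialStep ρ L N then Module.finrank K ↥L - Module.finrank K ↥N else 0 := by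
  by_cases hqt : IsQuasiTrivialStep ρ L N
  · rw [if_pos hqt]
    -- bound by the telescoping sum of all the steps of `b`
    have hmono : ∀ i < n, Module.finrank K ↥(b (i + 1)) ≤ Module.finrank K ↥(b i) := fun i hi =>
      Submodule.finrank_mono (hanti i hi)
    have hle' : (∑ i ∈ Finset.range n,
        if IsQuasiTrivialStep ρ (b i) (b (i + 1)) then
          Module.finrank K ↥(b i) - Module.finrank K ↥(b (i + 1)) else 0) ≤
        ∑ i ∈ Finset.range n, (Module.finrank K ↥(b i) - Module.finrank K ↥(b (i + 1))) :=
      Finset.sum_le_sum fun i _ => by split_ifs <;> simp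
    refine hle'.trans ?_
    have hZ : ((∑ i ∈ Finset.range n,
        (Module.finrank K ↥(b i) - Module.finrank K ↥(b (i + 1))) : ℕ) : ℤ) =
        (Module.finrank K ↥(b 0) : ℤ) - Module.finrank K ↥(b n) := by
      rw [Nat.cast_sum, Finset.sum_congr rfl fun i hi =>
        Nat.cast_sub (R := ℤ) (hmono i (Finset.mem_range.1 hi))]
      exact Finset.sum_range_sub' (fun i => (Module.finrank K ↥(b i) : ℤ)) n
    have h0 : Module.finrank K ↥(b 0) ≤ Module.finrank K ↥L := Submodule.finrank_mono (hle 0)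
    have hlast : Module.finrank K ↥N ≤ Module.finrank K ↥(b n) := Submodule.finrank_mono (hge n)
    have key : ((∑ i ∈ Finset.range n,
        (Module.finrank K ↥(b i) - Module.finrank K ↥(b (i + 1))) : ℕ) : ℤ) ≤
        ((Module.finrank K ↥L - Module.finrank K ↥N : ℕ) : ℤ) := by
      rw [hZ, Nat.cast_sub (Submodule.finrank_mono hNL)]
      omega
    exact_mod_cast key
  · rw [if_neg hqt]
    -- the step `L ⊇ N` has no nontrivial subquotients: every `b i` is `N` or `L`
    have hsimple : IsSimpleStep ρ L N := hadm.resolve_left hqt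
    have hval : ∀ i, b i = N ∨ b i = L := fun i => hsimple.2 (b i) (hst i) (hge i) (hle i)
    refine le_of_eq (Finset.sum_eq_zero fun i hi => ?_)
    have hi' : i < n := Finset.mem_range.1 hi
    by_cases heq : b (i + 1) = b i
    · rw [heq]; split_ifs <;> simp
    · -- then `b i = L`, `b (i+1) = N`, and the step is `L ⊇ N` itself: not quasi-trivial
      have h1 : b i = L := by
        rcases hval i with h | h
        · exfalso
          have h' : b i ≤ b (i + 1) := by rw [h]; exact hge (i + 1)
          exact heq (le_antisymm (hanti i hi') h')
        · exact h
      have h2 : b (i + 1) = N := by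
        rcases hval (i + 1) with h | h
        · exact h
        · exact absurd (h.trans h1.symm) heq
      rw [h1, h2, if_neg hqt]

/-- Induction step behind `qtDim_le_of_isAdmissible`: for an admissible filtration `c` and any
filtration `d`, the quasi-trivial total of `d ⊓ M_k` (the filtration `d` cut down to the `k`-th term
of `c`) is at most the quasi-trivial total of the tail `M_k ⊇ M_{k+1} ⊇ … ⊇ 0` of `c`.
[cite: MochizukiAbsTopI2012, Lemma 4.5 (ii) p.54] -/
theorem StableChain.qtDim_inf_le_of_isAdmissible [FiniteDimensional K M] {ρ : G →* (M ≃ₗ[K] M)}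
    {c : StableChain ρ} (hc : c.IsAdmissible) (d : StableChain ρ) {k : ℕ} (hk : k ≤ c.length) :
    (∑ i ∈ Finset.range d.length,
        if IsQuasiTrivialStep ρ (d.term i ⊓ c.term k) (d.term (i + 1) ⊓ c.term k) then
          Module.finrank K ↥(d.term i ⊓ c.term k) - Module.finrank K ↥(d.term (i + 1) ⊓ c.term k)
        else 0) ≤
      ∑ j ∈ Finset.Ico k c.length,
        if IsQuasiTrivialStep ρ (c.term j) (c.term (j + 1)) then
          Module.finrank K (c.term j) - Module.finrank K (c.term (j + 1)) else 0 := by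
  -- induction on the length `c.length - k` of the tail
  obtain ⟨m, hm⟩ : ∃ m, k + m = c.length := ⟨c.length - k, by omega⟩
  induction m generalizing k with
  | zero =>
    -- `k = c.length`: everything is cut down to `M_n = 0`
    have hk' : k = c.length := by omega
    subst hk'
    rw [c.term_length, Finset.Ico_self, Finset.sum_empty]
    refine le_of_eq (Finset.sum_eq_zero fun i _ => ?_)
    rw [inf_bot_eq, inf_bot_eq]
    split_ifs <;> simp
  | succ m ih =>
    have hkn : k < c.length := by omega
    have ih' := ih (k := k + 1) (by omega) (by omega)
    -- notation: `L = M_k ⊇ N = M_{k+1}`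
    have hNL : c.term (k + 1) ≤ c.term k := c.step_le k hkn
    have hL : IsStable ρ (c.term k) := c.stable k
    have hN : IsStable ρ (c.term (k + 1)) := c.stable (k + 1)
    -- split every summand along `N`
    have hsplit : ∀ i ∈ Finset.range d.length,
        (if IsQuasiTrivialStep ρ (d.term i ⊓ c.term k) (d.term (i + 1) ⊓ c.term k) then
            Module.finrank K ↥(d.term i ⊓ c.term k) -
              Module.finrank K ↥(d.term (i + 1) ⊓ c.term k) else 0) ≤
          (if IsQuasiTrivialStep ρ (d.term i ⊓ c.term (k + 1)) (d.term (i + 1) ⊓ c.term (k + 1)) then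
              Module.finrank K ↥(d.term i ⊓ c.term (k + 1)) -
                Module.finrank K ↥(d.term (i + 1) ⊓ c.term (k + 1)) else 0) +
          (if IsQuasiTrivialStep ρ (d.term i ⊓ c.term k ⊔ c.term (k + 1))
                (d.term (i + 1) ⊓ c.term k ⊔ c.term (k + 1)) then
              Module.finrank K ↥(d.term i ⊓ c.term k ⊔ c.term (k + 1)) -
                Module.finrank K ↥(d.term (i + 1) ⊓ c.term k ⊔ c.term (k + 1)) else 0) := by
      intro i hi
      have hi' : i < d.length := Finset.mem_range.1 hi
      have hstep : d.term (i + 1) ⊓ c.term k ≤ d.term i ⊓ c.term k :=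
        inf_le_inf_right _ (d.step_le i hi')
      -- `(d_i ⊓ L) ⊓ N = d_i ⊓ N`
      have e1 : d.term i ⊓ c.term k ⊓ c.term (k + 1) = d.term i ⊓ c.term (k + 1) := by
        rw [inf_assoc, inf_eq_right.2 hNL]
      have e2 : d.term (i + 1) ⊓ c.term k ⊓ c.term (k + 1) = d.term (i + 1) ⊓ c.term (k + 1) := by
        rw [inf_assoc, inf_eq_right.2 hNL]
      by_cases hq : IsQuasiTrivialStep ρ (d.term i ⊓ c.term k) (d.term (i + 1) ⊓ c.term k)
      · have hq1 : IsQuasiTrivialStep ρ (d.term i ⊓ c.term (k + 1))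
            (d.term (i + 1) ⊓ c.term (k + 1)) := by
          rw [← e1, ← e2]; exact hq.inf_right hN
        have hq2 := hq.sup_right hN
        rw [if_pos hq, if_pos hq1, if_pos hq2, finrank_sub_finrank_eq_inf_add_sup hstep (c.term (k + 1)),
          e1, e2]
      · rw [if_neg hq]; exact Nat.zero_le _
    refine (Finset.sum_le_sum hsplit).trans ?_
    rw [Finset.sum_add_distrib, Finset.sum_eq_sum_Ico_succ_bot hkn]
    -- the `⊔ N` parts: a monotone family squeezed between `N` and `L`
    have hpart2 := sum_qtDim_le_of_squeezed hNL (hc k hkn)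
      (fun i => d.term i ⊓ c.term k ⊔ c.term (k + 1)) d.length
      (fun i => sup_le inf_le_right hNL) (fun i => le_sup_right)
      (fun i hi => sup_le_sup_right (inf_le_inf_right _ (d.step_le i hi)) _)
      (fun i => ((d.stable i).inf hL).sup hN)
    exact le_trans (add_le_add ih' hpart2) (le_of_eq (add_comm _ _))

/-- **Every stable filtration's quasi-trivial total is at most that of any ADMISSIBLE filtration**
("refinement only moves dimension into quasi-trivial steps"). [cite: MochizukiAbsTopI2012, Lemma 4.5 (ii) p.54] -/
theorem StableChain.qtDim_le_of_isAdmissible [FiniteDimensional K M] {ρ : G →* (M ≃ₗ[K] M)}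
    {c : StableChain ρ} (hc : c.IsAdmissible) (d : StableChain ρ) : d.qtDim ≤ c.qtDim := by
  have h := StableChain.qtDim_inf_le_of_isAdmissible hc d (Nat.zero_le c.length)
  have e : ∀ i, d.term i ⊓ c.term 0 = d.term i := fun i => by rw [c.term_zero, inf_top_eq]
  have hL : d.qtDim = ∑ i ∈ Finset.range d.length,
      (if IsQuasiTrivialStep ρ (d.term i ⊓ c.term 0) (d.term (i + 1) ⊓ c.term 0) then
        Module.finrank K ↥(d.term i ⊓ c.term 0) - Module.finrank K ↥(d.term (i + 1) ⊓ c.term 0)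
      else 0) := by
    unfold StableChain.qtDim
    refine Finset.sum_congr rfl fun i _ => ?_
    rw [e i, e (i + 1)]
  have hR : c.qtDim = ∑ j ∈ Finset.Ico 0 c.length,
      (if IsQuasiTrivialStep ρ (c.term j) (c.term (j + 1)) then
        Module.finrank K ↥(c.term j) - Module.finrank K ↥(c.term (j + 1)) else 0) := by
    unfold StableChain.qtDim
    rw [Finset.range_eq_Ico]
  rw [hL, hR]
  exact h

/-- **Print's `τ(M)` = the trunk's `quasiTrivialRank`**: the quasi-trivial total of ANY admissible
filtration ("each `M_j/M_{j+1}` is either quasi-trivial or has no nontrivial subquotients",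
[AbsTopI] Lemma 4.5 (ii) p. 54 / [CombGC] Def. 2.3 (i)) equals the supremum over all stable
filtrations — the instance form of F-0226 that the typing relies on.
[cite: MochizukiAbsTopI2012, Lemma 4.5 (ii) p.54] [cite: MochizukiCombGC2007, Def. 2.3 (i) p.18] -/
theorem StableChain.IsAdmissible.qtDim_eq_quasiTrivialRank [FiniteDimensional K M]
    {ρ : G →* (M ≃ₗ[K] M)} {c : StableChain ρ} (hc : c.IsAdmissible) :
    c.qtDim = quasiTrivialRank ρ :=
  le_antisymm c.qtDim_le_quasiTrivialRank
    (csSup_le ⟨_, ⟨c, rfl⟩⟩ (by rintro _ ⟨d, rfl⟩; exact StableChain.qtDim_le_of_isAdmissible hc d))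

/-- Any two admissible filtrations have the same quasi-trivial total (print's well-definedness of
`τ(M)`, here WITHOUT Jordan–Hölder). [cite: MochizukiAbsTopI2012, Lemma 4.5 (ii) p.54] -/
theorem StableChain.IsAdmissible.qtDim_eq [FiniteDimensional K M] {ρ : G →* (M ≃ₗ[K] M)}
    {c c' : StableChain ρ} (hc : c.IsAdmissible) (hc' : c'.IsAdmissible) : c.qtDim = c'.qtDim := by
  rw [hc.qtDim_eq_quasiTrivialRank, hc'.qtDim_eq_quasiTrivialRank]

/-! ### Admissible filtrations exist -/

omit [TopologicalSpace G] in
/-- A nonzero stable submodule `N` of a finite-dimensional representation has a stable `P ⊂ N` such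
that `N ⊇ P` has no nontrivial subquotients (take a proper stable submodule of maximal dimension).
[cite: MochizukiAbsTopI2012, Lemma 4.5 (ii) p.54] -/
theorem exists_isSimpleStep_of_ne_bot [FiniteDimensional K M] (ρ : G →* (M ≃ₗ[K] M))
    {N : Submodule K M} (hne : N ≠ ⊥) :
    ∃ P : Submodule K M, IsStable ρ P ∧ IsSimpleStep ρ N P := by
  set S : Set (Submodule K M) := {P | IsStable ρ P ∧ P < N} with hS
  have hbot : (⊥ : Submodule K M) ∈ S := ⟨isStable_bot ρ, bot_lt_iff_ne_bot.2 hne⟩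
  set D : Set ℕ := (fun P : Submodule K M => Module.finrank K P) '' S with hD
  have hDne : D.Nonempty := ⟨_, ⟨⊥, hbot, rfl⟩⟩
  have hDbdd : BddAbove D := ⟨Module.finrank K M, by
    rintro _ ⟨P, -, rfl⟩; exact Submodule.finrank_le P⟩
  obtain ⟨P, ⟨hPst, hPlt⟩, hPdim⟩ := Nat.sSup_mem hDne hDbdd
  have hPdim' : Module.finrank K P = sSup D := hPdim
  refine ⟨P, hPst, hPlt, fun Q hQ hPQ hQN => ?_⟩
  by_cases hQeq : Q = N
  · exact Or.inr hQeq
  · left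
    have hQS : Q ∈ S := ⟨hQ, lt_of_le_of_ne hQN hQeq⟩
    have hdim : Module.finrank K Q ≤ Module.finrank K P := by
      rw [hPdim']; exact le_csSup hDbdd ⟨Q, hQS, rfl⟩
    exact (Submodule.eq_of_le_of_finrank_le hPQ hdim).symm

/-- **A finite-dimensional representation has an admissible filtration** — indeed one all of whose
steps have no nontrivial subquotients (descend through proper stable submodules of maximal
dimension); so print's "ANY [admissible] filtration" is never vacuous.
[cite: MochizukiAbsTopI2012, Lemma 4.5 (ii) p.54] [cite: MochizukiCombGC2007, Def. 2.3 (i) p.18] -/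
theorem StableChain.exists_isAdmissible [FiniteDimensional K M] (ρ : G →* (M ≃ₗ[K] M)) :
    ∃ c : StableChain ρ, c.IsAdmissible ∧
      ∀ j < c.length, IsSimpleStep ρ (c.term j) (c.term (j + 1)) := by
  -- one descent step
  let next : Submodule K M → Submodule K M := fun N =>
    if h : N ≠ ⊥ then Classical.choose (exists_isSimpleStep_of_ne_bot ρ h) else ⊥
  have hnext : ∀ N : Submodule K M, N ≠ ⊥ → IsStable ρ (next N) ∧ IsSimpleStep ρ N (next N) := by
    intro N hN
    simp only [next, dif_pos hN]
    exact Classical.choose_spec (exists_isSimpleStep_of_ne_bot ρ hN)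
  have hnext_bot : next ⊥ = ⊥ := by simp [next]
  -- iterate it from `⊤`
  let tm : ℕ → Submodule K M := fun j => next^[j] ⊤
  have tm_zero : tm 0 = ⊤ := rfl
  have tm_succ : ∀ j, tm (j + 1) = next (tm j) := fun j =>
    Function.iterate_succ_apply' next j ⊤
  have hstable : ∀ j, IsStable ρ (tm j) := by
    intro j
    induction j with
    | zero => exact isStable_top ρ
    | succ j ih =>
      rw [tm_succ]
      by_cases h : tm j = ⊥
      · rw [h, hnext_bot]; exact isStable_bot ρ
      · exact (hnext _ h).1
  have hle : ∀ j, tm (j + 1) ≤ tm j := by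
    intro j
    rw [tm_succ]
    by_cases h : tm j = ⊥
    · rw [h, hnext_bot]
    · exact (hnext _ h).2.1.le
  -- dimensions drop by at least one until `⊥` is reached
  have hdim : ∀ j, tm j = ⊥ ∨ Module.finrank K (tm j) + j ≤ Module.finrank K M := by
    intro j
    induction j with
    | zero => right; rw [tm_zero, finrank_top]; simp
    | succ j ih =>
      by_cases h : tm j = ⊥
      · left; rw [tm_succ, h, hnext_bot]
      · right
        rcases ih with h' | h'
        · exact absurd h' h
        · have hlt : Module.finrank K (tm (j + 1)) < Module.finrank K (tm j) := by
            rw [tm_succ]; exact Submodule.finrank_lt_finrank_of_lt (hnext _ h).2.1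
          omega
  have hex : ∃ j, tm j = ⊥ := by
    refine ⟨Module.finrank K M + 1, ?_⟩
    rcases hdim (Module.finrank K M + 1) with h | h
    · exact h
    · omega
  let c : StableChain ρ :=
    { length := Nat.find hex
      term := tm
      term_zero := tm_zero
      term_length := Nat.find_spec hex
      step_le := fun j _ => hle j
      stable := hstable }
  refine ⟨c, ?_, ?_⟩
  · intro j hj
    right
    have hne : tm j ≠ ⊥ := Nat.find_min hex hj
    show IsSimpleStep ρ (tm j) (tm (j + 1))
    rw [tm_succ]
    exact (hnext _ hne).2
  · intro j hj
    have hne : tm j ≠ ⊥ := Nat.find_min hex hj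
    show IsSimpleStep ρ (tm j) (tm (j + 1))
    rw [tm_succ]
    exact (hnext _ hne).2

/-- Hence `τ(M)` is ATTAINED: some admissible filtration has quasi-trivial total `quasiTrivialRank ρ`.
[cite: MochizukiAbsTopI2012, Lemma 4.5 (ii) p.54] -/
theorem exists_isAdmissible_qtDim_eq [FiniteDimensional K M] (ρ : G →* (M ≃ₗ[K] M)) :
    ∃ c : StableChain ρ, c.IsAdmissible ∧ c.qtDim = quasiTrivialRank ρ := by
  obtain ⟨c, hc, -⟩ := StableChain.exists_isAdmissible ρ
  exact ⟨c, hc, hc.qtDim_eq_quasiTrivialRank⟩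

/-! ### F-0226 `StableChain.IsAdmissible`: instance forms, and the universal closure is FALSE -/

/-- The one-step filtration `M ⊇ 0` is admissible iff `M` itself is quasi-trivial or has no
nontrivial stable submodules. [cite: MochizukiAbsTopI2012, Lemma 4.5 (ii) p.54] -/
theorem StableChain.isAdmissible_trivial_iff (ρ : G →* (M ≃ₗ[K] M)) :
    (StableChain.trivial ρ).IsAdmissible ↔ IsQuasiTrivialStep ρ ⊤ ⊥ ∨ IsSimpleStep ρ ⊤ ⊥ := by
  unfold StableChain.IsAdmissible
  have h0 : (StableChain.trivial ρ).term 0 = ⊤ := rfl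
  have h1 : (StableChain.trivial ρ).term (0 + 1) = ⊥ := rfl
  have hl : (StableChain.trivial ρ).length = 1 := rfl
  rw [hl]
  constructor
  · intro h
    have := h 0 Nat.one_pos
    rwa [h0, h1] at this
  · intro h j hj
    have hj0 : j = 0 := by omega
    subst hj0
    rwa [h0, h1]

/-- Instance form: if an open subgroup of finite index acts trivially on `M` (the representation is
quasi-trivial), the filtration `M ⊇ 0` is admissible. [cite: MochizukiAbsTopI2012, Lemma 4.5 (ii) p.54] -/
theorem StableChain.isAdmissible_trivial_of_quasiTrivial (ρ : G →* (M ≃ₗ[K] M))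
    (h : ∃ U : Subgroup G, IsOpen (U : Set G) ∧ U.FiniteIndex ∧ ∀ g ∈ U, ρ g = 1) :
    (StableChain.trivial ρ).IsAdmissible := by
  rw [StableChain.isAdmissible_trivial_iff]
  left
  obtain ⟨U, hU, hfi, hact⟩ := h
  exact ⟨U, hU, hfi, fun g hg m _ => by simp [hact g hg]⟩

end Admissible

section UniversalClosure

/-- `ℚˣ` is infinite (the powers of `2` are distinct); private helper for the witness below. [folklore] -/
private theorem infinite_units_rat : Infinite ℚˣ := by
  refine Infinite.of_injective (fun n : ℕ => (Units.mk0 (2 : ℚ) two_ne_zero) ^ n) fun a b h => ?_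
  have h' := congrArg (fun u : ℚˣ => (u : ℚ)) h
  simp only [Units.val_pow_eq_pow_val, Units.val_mk0] at h'
  exact Nat.pow_right_injective (le_refl 2) (by exact_mod_cast h')

/-- **F-0226: the universal closure of `StableChain.IsAdmissible` is FALSE** (witness: `G = ℚˣ`
discrete acting by scalars on `M = ℚ²`; the filtration `ℚ² ⊇ 0` is neither quasi-trivial — only
`g = 1` fixes `(1,0)`, and `{1}` has infinite index — nor without nontrivial subquotients — the line
`ℚ ⊕ 0` is stable).  So the row is a schema; its instance forms are `isAdmissible_trivial_iff`,
`isAdmissible_trivial_of_quasiTrivial`, `StableChain.exists_isAdmissible` and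
`StableChain.IsAdmissible.qtDim_eq_quasiTrivialRank`. [cite: MochizukiAbsTopI2012, Lemma 4.5 (ii) p.54] -/
theorem not_forall_isAdmissible :
    ¬ ∀ (G : Type) [Group G] [TopologicalSpace G] (K : Type) [Field K] (M : Type) [AddCommGroup M]
        [Module K M] (ρ : G →* (M ≃ₗ[K] M)) (c : StableChain ρ), c.IsAdmissible := by
  intro h
  letI : TopologicalSpace ℚˣ := ⊥
  let ρ : ℚˣ →* ((ℚ × ℚ) ≃ₗ[ℚ] (ℚ × ℚ)) := DistribMulAction.toModuleAut ℚ (ℚ × ℚ)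
  have hρ : ∀ (g : ℚˣ) (m : ℚ × ℚ), ρ g m = (g : ℚ) • m := fun g m => rfl
  have hadm := (StableChain.isAdmissible_trivial_iff ρ).1 (h ℚˣ ℚ (ℚ × ℚ) ρ (StableChain.trivial ρ))
  rcases hadm with ⟨U, -, hfi, hact⟩ | ⟨-, hsimple⟩
  · -- quasi-trivial: `U` fixes `(1,0)`, so `U = ⊥`, contradicting finite index in the infinite `ℚˣ`
    have hU : U = ⊥ := by
      refine (Subgroup.eq_bot_iff_forall U).2 fun g hg => ?_
      have h1 := hact g hg (1, 0) Submodule.mem_top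
      rw [Submodule.mem_bot, sub_eq_zero, hρ] at h1
      have h2 := congrArg Prod.fst h1
      simp only [Prod.smul_fst, smul_eq_mul, mul_one] at h2
      exact Units.ext h2
    haveI := hfi
    haveI := infinite_units_rat
    have hidx := Subgroup.FiniteIndex.index_ne_zero (H := U)
    rw [hU, Subgroup.index_bot, Nat.card_eq_zero_of_infinite] at hidx
    exact hidx rfl
  · -- no nontrivial subquotients: but the line `ℚ ⊕ 0` is a stable submodule strictly between
    let P : Submodule ℚ (ℚ × ℚ) := LinearMap.range (LinearMap.inl ℚ ℚ ℚ)
    have hP : IsStable ρ P := by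
      rintro g _ ⟨x, rfl⟩
      exact ⟨(g : ℚ) • x, by rw [hρ]; simp⟩
    rcases hsimple P hP bot_le le_top with hbot | htop
    · have hmem : ((1 : ℚ), (0 : ℚ)) ∈ P := ⟨1, by simp⟩
      rw [hbot, Submodule.mem_bot] at hmem
      exact one_ne_zero (congrArg Prod.fst hmem)
    · have hmem : ((0 : ℚ), (1 : ℚ)) ∈ P := by rw [htop]; exact Submodule.mem_top
      obtain ⟨x, hx⟩ := hmem
      have := congrArg Prod.snd hx
      simp at this

end UniversalClosure

end Literature.AnabelianGeometry.AbsoluteAnabelian.AbsTopI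

end
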